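import Summits.AtomisticToContinuum.FouriersLaw.Theses.OddSectorIrreversibility
import Literature.MathematicalPhysics.KineticTheory.LangevinChainGibbs

/-!
# OddResponseBound — the equilibrium echo floor breaks the route; SI's falsifiable equilibrium prediction (negative-side support)

Support lemmas for crux `OddSectorIrreversibility.OddResponseBound` (item stmt-AtomisticToContinuum-9140, "SI")
from the standing disprover's work file `Cruxes/OddResponseBound/Disproof.lean` §3; sorry-free, no new
definitions.

The route's own McLennan calculus (support item `OddDensityIsCorrector`: `h − h∘Θ = (u − u∘Θ)/((N−1)T²)`,
`u_N = ∫₀^∞ P_t J_tot dt` the Kubo corrector of the EQUILIBRIUM open chain) turns SI into a statement about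
equilibrium dynamics only. Two readings, both proved here from the route's items as hypotheses:

* `corrector_oddNormSq_le_of_oddResponseBound` — SI's FALSIFIABLE EQUILIBRIUM PREDICTION: under
  `NessUnique`, `ResponseDensity`, `OddDensityIsCorrector`, SI forces
  `∫ (u_N − u_N∘Θ)² dGibbs_T ≤ C (N−1)² T⁴ / N = O(N)` for every `L²` version of the corrector. The
  disprover's heuristic (Disproof.lean §3: for a deterministic bulk the time-integrated bulk currents over
  times `≍ N` are `X₀`-measurable, so Cauchy–Schwarz with `Y = ∫_{−bN}^{bN} J_bulk∘Φ_s ds` and Green–Kubo give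
  `‖u−uΘ‖² ≳ 4bN²κT²(1−2vb)`) predicts `≍ N²` instead (MD test: kit job j008869); stochastic bulks give `≍ N`.
* `oddResponseBound_false_of_echoFloor` — conversely an equilibrium floor `c N² ≤ ∫ (u_N − u_N∘Θ)² dGibbs_T`
  for large `N` (hypotheses inline) together with the three support items REFUTES SI: the route is
  self-defeating if its McLennan calculus holds and the chain is a deterministic normal conductor.
Nothing here closes an item.
-/

noncomputable section

open MeasureTheory Filter Topology Set
open Literature.MathematicalPhysics.KineticTheory.HeatConduction
open Summit.AtomisticToContinuum.FouriersLaw.Theses.OddSectorIrreversibility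

namespace Summit.AtomisticToContinuum.FouriersLaw.Theorems.OddResponseBound.Negative.EchoFloor

/-- A steady-state family of the pinned anharmonic chain exists (choice over the PROVED existence
`pinnedChain_exists_isSteadyState`). [folklore] -/
theorem exists_steadyStateFamily {ω₂ lam β γ : ℝ} (hω : 0 < ω₂) (hl : 0 < lam) (hβ : 0 < β)
    (hγ : 0 < γ) :
    ∃ μ₀ : (N : ℕ) → ℝ → ℝ → Measure (PhaseSpace N), ∀ (N : ℕ) (T_L T_R : ℝ), 0 < T_L → 0 < T_R →
      (pinnedChain ω₂ lam β γ).IsSteadyState N T_L T_R (μ₀ N T_L T_R) := by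
  classical
  refine ⟨fun N T_L T_R => if h : 0 < T_L ∧ 0 < T_R then
    Classical.choose (pinnedChain_exists_isSteadyState hω hl hβ hγ N h.1 h.2) else 0, ?_⟩
  intro N T_L T_R h1 h2
  simp only [dif_pos (And.intro h1 h2)]
  exact Classical.choose_spec (pinnedChain_exists_isSteadyState hω hl hβ hγ N h1 h2)

/-- **SI's falsifiable equilibrium prediction.** Under the route's support items `NessUnique`,
`ResponseDensity`, `OddDensityIsCorrector`, the crux `OddResponseBound` forces, for all parameters
`> 0` and `T > 0`, a constant `C` with: for every `N ≥ 2` and EVERY `u ∈ L²(Gibbs_T)` that is Gibbs-a.e.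
the `τ → ∞` limit of `∫₀^τ (P_t J_tot)(x) dt` (the Kubo corrector of the equilibrium open chain),
`∫ (u − u∘Θ)² dGibbs_T ≤ C ((N−1)T²)² / N` — i.e. `‖P_odd u_N‖² = O(N)`. (Uniqueness identifies
`μ_{N,T,T}` with Gibbs, `pinnedChain_isSteadyState_gibbsMeasure`; a.e. limits are a.e. unique.)
[folklore] -/
theorem corrector_oddNormSq_le_of_oddResponseBound (hSI : OddResponseBound) (hU : NessUnique)
    (hR : ResponseDensity) (hO : OddDensityIsCorrector) {ω₂ lam β γ : ℝ} (hω : 0 < ω₂) (hl : 0 < lam)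
    (hβ : 0 < β) (hγ : 0 < γ) {T : ℝ} (hT : 0 < T) :
    ∃ C : ℝ, ∀ (N : ℕ), 2 ≤ N → ∀ u : PhaseSpace N → ℝ,
      MemLp u 2 ((pinnedChain ω₂ lam β γ).gibbsMeasure N T) →
      (∀ᵐ x ∂((pinnedChain ω₂ lam β γ).gibbsMeasure N T), Tendsto (fun τ : ℝ => ∫ t in Set.Ioc (0 : ℝ) τ,
          (∫ y, (∑ i : Fin N, (pinnedChain ω₂ lam β γ).bondCurrent N i y)
            ∂((pinnedChain ω₂ lam β γ).transitionKernel N T T t.toNNReal x))) atTop (𝓝 (u x))) →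
      ∫ x, (u x - u (x.1, -x.2)) ^ 2 ∂((pinnedChain ω₂ lam β γ).gibbsMeasure N T) ≤
        C * (((N : ℝ) - 1) * T ^ 2) ^ 2 / N := by
  have hUq := hU ω₂ lam β γ hω hl hβ hγ
  obtain ⟨μ₀, hμ₀⟩ := exists_steadyStateFamily hω hl hβ hγ
  obtain ⟨C, hC⟩ := hSI ω₂ lam β γ hω hl hβ hγ hUq μ₀ hμ₀ T hT
  refine ⟨C, fun N hN2 u hu2 hlim => ?_⟩
  obtain ⟨h, hmem, hF, hcur⟩ := hR ω₂ lam β γ hω hl hβ hγ hUq μ₀ hμ₀ T hT N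
  obtain ⟨_, hbound⟩ := hC N h hN2 ⟨hmem, hF, hcur⟩
  obtain ⟨u', hu2', hlim', hident⟩ := hO ω₂ lam β γ hω hl hβ hγ hUq μ₀ hμ₀ T hT N h hN2 ⟨hmem, hF, hcur⟩
  have hG : μ₀ N T T = (pinnedChain ω₂ lam β γ).gibbsMeasure N T :=
    hUq N T T hT hT _ _ (hμ₀ N T T hT hT)
      (pinnedChain_isSteadyState_gibbsMeasure hω hl.le hβ.le γ N hT)
  rw [hG] at hlim' hident hbound
  -- the two versions of the corrector agree a.e. (limits along `atTop` are unique)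
  have huu : ∀ᵐ x ∂((pinnedChain ω₂ lam β γ).gibbsMeasure N T), u' x = u x := by
    filter_upwards [hlim, hlim'] with x hx hx'
    exact tendsto_nhds_unique hx' hx
  -- Θ-image of an a.e. statement: the Gibbs measure is quasi-invariant under momentum reversal
  have hΘ : MeasurePreserving (momentumReversal N) ((pinnedChain ω₂ lam β γ).gibbsMeasure N T)
      ((pinnedChain ω₂ lam β γ).gibbsMeasure N T) := by
    refine ⟨(momentumReversal N).measurable, Measure.ext fun s hs => ?_⟩
    rw [Measure.map_apply (momentumReversal N).measurable hs, OscillatorChain.gibbsMeasure,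
      Measure.tilted, withDensity_apply _ ((momentumReversal N).measurable hs), withDensity_apply _ hs]
    have key := (measurePreserving_momentumReversal N).setLIntegral_comp_preimage_emb
      (momentumReversal N).measurableEmbedding
      (fun x => ENNReal.ofReal (Real.exp (-(pinnedChain ω₂ lam β γ).hamiltonian N x / T) /
        ∫ x, Real.exp (-(pinnedChain ω₂ lam β γ).hamiltonian N x / T))) s
    simpa only [momentumReversal_apply, OscillatorChain.hamiltonian_neg_momentum] using key
  have huuΘ : ∀ᵐ x ∂((pinnedChain ω₂ lam β γ).gibbsMeasure N T), u' (x.1, -x.2) = u (x.1, -x.2) := by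
    have := hΘ.quasiMeasurePreserving.ae_eq_comp huu
    filter_upwards [this] with x hx
    simpa [momentumReversal_apply] using hx
  have heq : ∫ x, (h x - h (x.1, -x.2)) ^ 2 ∂((pinnedChain ω₂ lam β γ).gibbsMeasure N T) =
      (∫ x, (u x - u (x.1, -x.2)) ^ 2 ∂((pinnedChain ω₂ lam β γ).gibbsMeasure N T)) /
        (((N : ℝ) - 1) * T ^ 2) ^ 2 := by
    rw [← integral_div]
    refine integral_congr_ae ?_
    filter_upwards [hident, huu, huuΘ] with x hx h1 h2
    rw [hx, h1, h2, div_pow]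
  rw [heq] at hbound
  have hN2r : (2 : ℝ) ≤ N := by exact_mod_cast hN2
  have hNpos : (0 : ℝ) < N := by linarith
  have hden : 0 < (((N : ℝ) - 1) * T ^ 2) ^ 2 := by
    have : 0 < ((N : ℝ) - 1) * T ^ 2 := by
      have : (0 : ℝ) < (N : ℝ) - 1 := by linarith
      positivity
    positivity
  -- N · I / K² ≤ C  ⇒  I ≤ C K² / N
  rw [le_div_iff₀ hNpos, mul_comm]
  have := mul_le_mul_of_nonneg_right hbound hden.le
  rwa [mul_assoc, div_mul_cancel₀ _ hden.ne'] at this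

/-- **The equilibrium echo floor breaks the route.** If for some parameters `> 0`, `T > 0`, `c > 0` and
all large `N` every `L²(Gibbs_T)` version `u` of the Kubo corrector of the equilibrium open chain has
`c N² ≤ ∫ (u − u∘Θ)² dGibbs_T` (the disprover's `EquilibriumEchoFloor`; heuristically
`≈ 4bN²κT²(1−2vb)` for a deterministic normal conductor), then the route's support items `NessUnique`,
`ResponseDensity`, `OddDensityIsCorrector` REFUTE the crux `OddResponseBound`
(`a_N ≥ c N / T⁴ → ∞`). [folklore] -/
theorem oddResponseBound_false_of_echoFloor {ω₂ lam β γ T : ℝ} (hω : 0 < ω₂) (hl : 0 < lam)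
    (hβ : 0 < β) (hγ : 0 < γ) (hT : 0 < T) {c : ℝ} (hc : 0 < c) {N₀ : ℕ}
    (hfloor : ∀ N : ℕ, N₀ ≤ N → ∀ u : PhaseSpace N → ℝ,
      MemLp u 2 ((pinnedChain ω₂ lam β γ).gibbsMeasure N T) →
      (∀ᵐ x ∂((pinnedChain ω₂ lam β γ).gibbsMeasure N T), Tendsto (fun τ : ℝ => ∫ t in Set.Ioc (0 : ℝ) τ,
          (∫ y, (∑ i : Fin N, (pinnedChain ω₂ lam β γ).bondCurrent N i y)
            ∂((pinnedChain ω₂ lam β γ).transitionKernel N T T t.toNNReal x))) atTop (𝓝 (u x))) →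
      c * (N : ℝ) ^ 2 ≤ ∫ x, (u x - u (x.1, -x.2)) ^ 2 ∂((pinnedChain ω₂ lam β γ).gibbsMeasure N T))
    (hU : NessUnique) (hR : ResponseDensity) (hO : OddDensityIsCorrector) : ¬ OddResponseBound := by
  intro hSI
  obtain ⟨C, hC⟩ := corrector_oddNormSq_le_of_oddResponseBound hSI hU hR hO hω hl hβ hγ hT
  have hUq := hU ω₂ lam β γ hω hl hβ hγ
  obtain ⟨μ₀, hμ₀⟩ := exists_steadyStateFamily hω hl hβ hγ
  have hev1 : ∀ᶠ N : ℕ in atTop, N₀ ≤ N := eventually_ge_atTop N₀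
  have hev2 : ∀ᶠ N : ℕ in atTop, 2 ≤ N := eventually_ge_atTop 2
  have hev3 : ∀ᶠ N : ℕ in atTop, C * T ^ 4 / c < (N : ℝ) :=
    (tendsto_natCast_atTop_atTop (R := ℝ)).eventually_gt_atTop _
  obtain ⟨N, hNN₀, hN2, hN3⟩ := (hev1.and (hev2.and hev3)).exists
  -- a version of the corrector at this N: from the response density via OddDensityIsCorrector
  obtain ⟨h, hmem, hF, hcur⟩ := hR ω₂ lam β γ hω hl hβ hγ hUq μ₀ hμ₀ T hT N
  obtain ⟨u, hu2, hlim, -⟩ := hO ω₂ lam β γ hω hl hβ hγ hUq μ₀ hμ₀ T hT N h hN2 ⟨hmem, hF, hcur⟩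
  have hG : μ₀ N T T = (pinnedChain ω₂ lam β γ).gibbsMeasure N T :=
    hUq N T T hT hT _ _ (hμ₀ N T T hT hT)
      (pinnedChain_isSteadyState_gibbsMeasure hω hl.le hβ.le γ N hT)
  rw [hG] at hu2 hlim
  have hup := hC N hN2 u hu2 hlim
  have hlow := hfloor N hNN₀ u hu2 hlim
  have hN2r : (2 : ℝ) ≤ N := by exact_mod_cast hN2
  have hNpos : (0 : ℝ) < N := by linarith
  have hT4 : (0 : ℝ) < T ^ 4 := by positivity
  -- c N² ≤ C ((N−1)T²)²/N ≤ C N² T⁴ / N = C N T⁴  ⇒  c N ≤ C T⁴, contradicting N > C T⁴ / c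
  have h1 : c * (N : ℝ) ^ 2 ≤ C * (((N : ℝ) - 1) * T ^ 2) ^ 2 / N := hlow.trans hup
  have hCnn : 0 ≤ C := by
    have hden : 0 < (((N : ℝ) - 1) * T ^ 2) ^ 2 := by
      have : 0 < ((N : ℝ) - 1) * T ^ 2 := by
        have : (0 : ℝ) < (N : ℝ) - 1 := by linarith
        positivity
      positivity
    have hK : 0 < (((N : ℝ) - 1) * T ^ 2) ^ 2 / N := div_pos hden hNpos
    by_contra hCneg
    have hCneg' : C < 0 := lt_of_not_ge hCneg
    have hneg : C * ((((N : ℝ) - 1) * T ^ 2) ^ 2 / N) < 0 := mul_neg_of_neg_of_pos hCneg' hK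
    have h1' : c * (N : ℝ) ^ 2 ≤ C * ((((N : ℝ) - 1) * T ^ 2) ^ 2 / N) := by
      rwa [mul_div_assoc] at h1
    have hpos : 0 < c * (N : ℝ) ^ 2 := by positivity
    linarith
  have h2 : C * (((N : ℝ) - 1) * T ^ 2) ^ 2 / N ≤ C * (N : ℝ) * T ^ 4 := by
    rw [div_le_iff₀ hNpos]
    have hle : (((N : ℝ) - 1) * T ^ 2) ^ 2 ≤ (N : ℝ) ^ 2 * T ^ 4 := by
      have hle' : ((N : ℝ) - 1) ^ 2 ≤ (N : ℝ) ^ 2 := by nlinarith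
      calc (((N : ℝ) - 1) * T ^ 2) ^ 2 = ((N : ℝ) - 1) ^ 2 * T ^ 4 := by ring
        _ ≤ (N : ℝ) ^ 2 * T ^ 4 := mul_le_mul_of_nonneg_right hle' hT4.le
    calc C * (((N : ℝ) - 1) * T ^ 2) ^ 2 ≤ C * ((N : ℝ) ^ 2 * T ^ 4) :=
          mul_le_mul_of_nonneg_left hle hCnn
      _ = C * (N : ℝ) * T ^ 4 * N := by ring
  have h3 : c * (N : ℝ) ≤ C * T ^ 4 := by
    have := h1.trans h2
    nlinarith
  have h4 : C * T ^ 4 < c * (N : ℝ) := by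
    have h5 := hN3
    rw [div_lt_iff₀ hc] at h5
    linarith
  linarith

end Summit.AtomisticToContinuum.FouriersLaw.Theorems.OddResponseBound.Negative.EchoFloor
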